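import Summits.ValiantsHypothesis.ValiantsHypothesis.Theorems.LacunarySymmetroidMatrixDescartesCensusDoorA34ConfluentNineteenKernel

/-!
# `MatrixDescartes` census — DOOR A at `(3,4)`: THE CONFLUENT NINETEEN — the coalesced corner of `DoorA34` itself: for EVERY support
# `(0, d₁, d₂, d₃)` with `2d₁ < d₂ < d₃`, a real `3 × 3` four-letter pencil `1 + X^{d₁}S₁ + X^{d₂}S₂ + X^{d₃}S₃` with SYMMETRIC `S₁`
# (and ARBITRARY `S₂, S₃`) has NO positive root of the Descartes-maximal multiplicity `19`

HONEST FRAMING.  Object-search cell `pub-symmetroid`, door-A seat `val-sym-door-p3` (g25); helper file beside the OPEN typed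
statement `DoorA34 = PosRootLawAt 3 4 18` (route item `Theses.LacunarySymmetroid.DoorA34`, stmt-ValiantsHypothesis-19980),
asserted nowhere here.  `DoorA34` says: at most `18` DISTINCT positive roots.  This file types the totally COALESCED corner of the
same statement — `19` roots merged into one — for every support whose second exponent exceeds twice the first (this includes every
(3,4) support of record of the census: `(0,1,7,11)`, `(0,1,4,13)`, `(0,4,9,16)`, `(0,8,17,29)`, `(0,6,20,29)`, `(0,1,4,32)`, `(0,10,22,38)`,
`(0,2,5,33)`), with an elementary mechanism:

* (part 1, `…ConfluentNineteenKernel`: `det_pencil_four_eq_sum_twenty` — the pencil determinant as the explicit twenty-term fewnomial on the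
  triple sums, any real letters, any `d`; the scaling `X ↦ x₀X`);
* the confluent Vandermonde kernel (`two_point_relation'`, part 1) at the exponents `d₁` and `2d₁` against `0`:
  `tr S₁ = −π(0)/π(d₁)`-type closed forms with `π(e) = ∏_{e' ≠ e}(e − e')` over the twenty sums;
* when `d₂ > 2d₁` the only sums below `2d₁` are `0, d₁`, so all signs are determined, and the MAGNITUDE inequality
  `|π(0)|·|π(2d₁)| < 3·π(d₁)²` reduces — after the pure multiples `d₁, 2d₁, 3d₁` contribute exactly the Newton constant `3` — to the
  termwise `e(e − 2d₁) < (e − d₁)²` over the sixteen mixed sums `e`; hence `(tr S₁)² < 3e₂(S₁)`, impossible for a real symmetric `S₁`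
  (`three_e2_le_trace_sq_of_isSymm`, part 5: a sum of squares of entries).

Main theorem **`not_nineteenfold_root_of_two_mul_lt`** (any `x₀`, by the scaling `X ↦ x₀X`).  No 3-Sidon hypothesis is needed (exponent
collisions among the mixed sums are allowed).  Honest: a statement about the multiplicity-`19` stratum only — it does not bound the number of
DISTINCT roots («no 19-fold contact does not by itself bound the count»); `DoorA34`, Claim L and `MatrixDescartes` (stmt-ValiantsHypothesis-18050)
stay OPEN; registers unchanged (`ζ_sym(3,4) ∈ {18,19}`); nothing on `VP ≠ VNP`.
[folklore] divided differences, Leibniz expansion, Newton's inequality `(tr A)² ≥ 3e₂(A)` for real symmetric `3 × 3` `A`; certificates by `ring` /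
`positivity` / `nlinarith`.
-/

-- `Summit.ValiantsHypothesis.ValiantsHypothesis.…` repeats a component by the D-0017 layout
-- (single-conjunct summit), which the `dupNamespace` linter flags; the name is mandated.
set_option linter.dupNamespace false

namespace Summit.ValiantsHypothesis.ValiantsHypothesis.Theorems.LacunarySymmetroidMatrixDescartes.Census.ConfluentNine

open Polynomial Finset
open scoped BigOperators Matrix

/-! ## 14. The coalesced nineteen with `d₂ > 2d₁`: the middle... the FIRST letter cannot be symmetric -/

set_option maxHeartbeats 2000000 in
/-- **NO NINETEENFOLD ROOT WHEN `2d₁ < d₂ < d₃` (ALL such supports; the coalesced corner of `DoorA34`).**  For any support with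
`0 < d₁`, `2d₁ < d₂ < d₃`, any real SYMMETRIC `S₁`, ANY real `S₂, S₃` and any `x₀`:
`(X − x₀)¹⁹ ∤ det(1 + X^{d₁}S₁ + X^{d₂}S₂ + X^{d₃}S₃)`.  Mechanism: with `π(e) = ∏_{e'≠e}(e − e')` over the twenty triple sums, a
nineteenfold root at `1` forces `tr S₁ = −6d₁²·P_e/(2d₁²·P₁)` and `e₂(S₁) = 3d₁²·P_e/(d₁²·P₂)` where `P_e = ∏ e`, `P₁ = ∏(e − d₁)`,
`P₂ = ∏(e − 2d₁)` over the sixteen mixed sums `e > 2d₁`; then `(tr S₁)² − 3e₂(S₁) = 9P_e(P_eP₂ − P₁²)/(P₁²P₂) < 0` because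
`e(e − 2d₁) < (e − d₁)²` termwise — against `(tr S₁)² ≥ 3e₂(S₁)` for real symmetric `S₁`. [folklore] -/
theorem not_nineteenfold_root_of_two_mul_lt (d₁ d₂ d₃ : ℕ) (S₁ S₂ S₃ : Matrix (Fin 3) (Fin 3) ℝ) (h0 : 0 < d₁) (h12 : 2 * d₁ < d₂)
    (h23 : d₂ < d₃) (hS₁ : S₁.IsSymm) (x₀ : ℝ) :
    ¬ (X - C x₀) ^ 19 ∣ (∑ l, (X : ℝ[X]) ^ (![0, d₁, d₂, d₃] : Fin 4 → ℕ) l • ((![1, S₁, S₂, S₃] : Fin 4 → Matrix (Fin 3) (Fin 3) ℝ) l).map C).det := by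
  intro h19
  have h := dvd_comp_scale_nineteen h19
  rw [det_pencil_four_comp_scale, det_pencil_four_eq_sum_twenty] at h
  have hcard : (Finset.univ : Finset (Fin 20)).card ≤ 19 + 1 := by rw [Finset.card_univ, Fintype.card_fin]
  have ha : (0 : ℝ) < d₁ := by exact_mod_cast h0
  have h12' : 2 * (d₁ : ℝ) < d₂ := by exact_mod_cast h12
  have h23' : (d₂ : ℝ) < d₃ := by exact_mod_cast h23
  have hb : (0 : ℝ) < d₂ := by linarith
  have hc : (0 : ℝ) < d₃ := by linarith
  -- the sixteen termwise inequalities and their product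
  have q0 : 0 < (d₂ : ℝ) - 2 * (d₁ : ℝ) := by linarith
  have f0 : 0 < (d₂ : ℝ) * ((d₂ : ℝ) - 2 * (d₁ : ℝ)) ∧ (d₂ : ℝ) * ((d₂ : ℝ) - 2 * (d₁ : ℝ)) < ((d₂ : ℝ) - (d₁ : ℝ)) ^ 2 :=
    ⟨by positivity, sub_pos.mp (by rw [show ((d₂ : ℝ) - (d₁ : ℝ)) ^ 2 - (d₂ : ℝ) * ((d₂ : ℝ) - 2 * (d₁ : ℝ)) = (d₁ : ℝ) ^ 2 by ring]; positivity)⟩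
  have q1 : 0 < (d₃ : ℝ) - 2 * (d₁ : ℝ) := by linarith
  have f1 : 0 < (d₃ : ℝ) * ((d₃ : ℝ) - 2 * (d₁ : ℝ)) ∧ (d₃ : ℝ) * ((d₃ : ℝ) - 2 * (d₁ : ℝ)) < ((d₃ : ℝ) - (d₁ : ℝ)) ^ 2 :=
    ⟨by positivity, sub_pos.mp (by rw [show ((d₃ : ℝ) - (d₁ : ℝ)) ^ 2 - (d₃ : ℝ) * ((d₃ : ℝ) - 2 * (d₁ : ℝ)) = (d₁ : ℝ) ^ 2 by ring]; positivity)⟩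
  have q2 : 0 < ((d₁ : ℝ) + (d₂ : ℝ)) - 2 * (d₁ : ℝ) := by linarith
  have f2 : 0 < ((d₁ : ℝ) + (d₂ : ℝ)) * (((d₁ : ℝ) + (d₂ : ℝ)) - 2 * (d₁ : ℝ)) ∧ ((d₁ : ℝ) + (d₂ : ℝ)) * (((d₁ : ℝ) + (d₂ : ℝ)) - 2 * (d₁ : ℝ)) < (((d₁ : ℝ) + (d₂ : ℝ)) - (d₁ : ℝ)) ^ 2 :=
    ⟨by positivity, sub_pos.mp (by rw [show (((d₁ : ℝ) + (d₂ : ℝ)) - (d₁ : ℝ)) ^ 2 - ((d₁ : ℝ) + (d₂ : ℝ)) * (((d₁ : ℝ) + (d₂ : ℝ)) - 2 * (d₁ : ℝ)) = (d₁ : ℝ) ^ 2 by ring]; positivity)⟩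
  have q3 : 0 < ((d₁ : ℝ) + (d₃ : ℝ)) - 2 * (d₁ : ℝ) := by linarith
  have f3 : 0 < ((d₁ : ℝ) + (d₃ : ℝ)) * (((d₁ : ℝ) + (d₃ : ℝ)) - 2 * (d₁ : ℝ)) ∧ ((d₁ : ℝ) + (d₃ : ℝ)) * (((d₁ : ℝ) + (d₃ : ℝ)) - 2 * (d₁ : ℝ)) < (((d₁ : ℝ) + (d₃ : ℝ)) - (d₁ : ℝ)) ^ 2 :=
    ⟨by positivity, sub_pos.mp (by rw [show (((d₁ : ℝ) + (d₃ : ℝ)) - (d₁ : ℝ)) ^ 2 - ((d₁ : ℝ) + (d₃ : ℝ)) * (((d₁ : ℝ) + (d₃ : ℝ)) - 2 * (d₁ : ℝ)) = (d₁ : ℝ) ^ 2 by ring]; positivity)⟩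
  have q4 : 0 < 2 * (d₂ : ℝ) - 2 * (d₁ : ℝ) := by linarith
  have f4 : 0 < 2 * (d₂ : ℝ) * (2 * (d₂ : ℝ) - 2 * (d₁ : ℝ)) ∧ 2 * (d₂ : ℝ) * (2 * (d₂ : ℝ) - 2 * (d₁ : ℝ)) < (2 * (d₂ : ℝ) - (d₁ : ℝ)) ^ 2 :=
    ⟨by positivity, sub_pos.mp (by rw [show (2 * (d₂ : ℝ) - (d₁ : ℝ)) ^ 2 - 2 * (d₂ : ℝ) * (2 * (d₂ : ℝ) - 2 * (d₁ : ℝ)) = (d₁ : ℝ) ^ 2 by ring]; positivity)⟩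
  have q5 : 0 < ((d₂ : ℝ) + (d₃ : ℝ)) - 2 * (d₁ : ℝ) := by linarith
  have f5 : 0 < ((d₂ : ℝ) + (d₃ : ℝ)) * (((d₂ : ℝ) + (d₃ : ℝ)) - 2 * (d₁ : ℝ)) ∧ ((d₂ : ℝ) + (d₃ : ℝ)) * (((d₂ : ℝ) + (d₃ : ℝ)) - 2 * (d₁ : ℝ)) < (((d₂ : ℝ) + (d₃ : ℝ)) - (d₁ : ℝ)) ^ 2 :=
    ⟨by positivity, sub_pos.mp (by rw [show (((d₂ : ℝ) + (d₃ : ℝ)) - (d₁ : ℝ)) ^ 2 - ((d₂ : ℝ) + (d₃ : ℝ)) * (((d₂ : ℝ) + (d₃ : ℝ)) - 2 * (d₁ : ℝ)) = (d₁ : ℝ) ^ 2 by ring]; positivity)⟩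
  have q6 : 0 < 2 * (d₃ : ℝ) - 2 * (d₁ : ℝ) := by linarith
  have f6 : 0 < 2 * (d₃ : ℝ) * (2 * (d₃ : ℝ) - 2 * (d₁ : ℝ)) ∧ 2 * (d₃ : ℝ) * (2 * (d₃ : ℝ) - 2 * (d₁ : ℝ)) < (2 * (d₃ : ℝ) - (d₁ : ℝ)) ^ 2 :=
    ⟨by positivity, sub_pos.mp (by rw [show (2 * (d₃ : ℝ) - (d₁ : ℝ)) ^ 2 - 2 * (d₃ : ℝ) * (2 * (d₃ : ℝ) - 2 * (d₁ : ℝ)) = (d₁ : ℝ) ^ 2 by ring]; positivity)⟩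
  have q7 : 0 < (2 * (d₁ : ℝ) + (d₂ : ℝ)) - 2 * (d₁ : ℝ) := by linarith
  have f7 : 0 < (2 * (d₁ : ℝ) + (d₂ : ℝ)) * ((2 * (d₁ : ℝ) + (d₂ : ℝ)) - 2 * (d₁ : ℝ)) ∧ (2 * (d₁ : ℝ) + (d₂ : ℝ)) * ((2 * (d₁ : ℝ) + (d₂ : ℝ)) - 2 * (d₁ : ℝ)) < ((2 * (d₁ : ℝ) + (d₂ : ℝ)) - (d₁ : ℝ)) ^ 2 :=
    ⟨by positivity, sub_pos.mp (by rw [show ((2 * (d₁ : ℝ) + (d₂ : ℝ)) - (d₁ : ℝ)) ^ 2 - (2 * (d₁ : ℝ) + (d₂ : ℝ)) * ((2 * (d₁ : ℝ) + (d₂ : ℝ)) - 2 * (d₁ : ℝ)) = (d₁ : ℝ) ^ 2 by ring]; positivity)⟩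
  have q8 : 0 < (2 * (d₁ : ℝ) + (d₃ : ℝ)) - 2 * (d₁ : ℝ) := by linarith
  have f8 : 0 < (2 * (d₁ : ℝ) + (d₃ : ℝ)) * ((2 * (d₁ : ℝ) + (d₃ : ℝ)) - 2 * (d₁ : ℝ)) ∧ (2 * (d₁ : ℝ) + (d₃ : ℝ)) * ((2 * (d₁ : ℝ) + (d₃ : ℝ)) - 2 * (d₁ : ℝ)) < ((2 * (d₁ : ℝ) + (d₃ : ℝ)) - (d₁ : ℝ)) ^ 2 :=
    ⟨by positivity, sub_pos.mp (by rw [show ((2 * (d₁ : ℝ) + (d₃ : ℝ)) - (d₁ : ℝ)) ^ 2 - (2 * (d₁ : ℝ) + (d₃ : ℝ)) * ((2 * (d₁ : ℝ) + (d₃ : ℝ)) - 2 * (d₁ : ℝ)) = (d₁ : ℝ) ^ 2 by ring]; positivity)⟩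
  have q9 : 0 < ((d₁ : ℝ) + 2 * (d₂ : ℝ)) - 2 * (d₁ : ℝ) := by linarith
  have f9 : 0 < ((d₁ : ℝ) + 2 * (d₂ : ℝ)) * (((d₁ : ℝ) + 2 * (d₂ : ℝ)) - 2 * (d₁ : ℝ)) ∧ ((d₁ : ℝ) + 2 * (d₂ : ℝ)) * (((d₁ : ℝ) + 2 * (d₂ : ℝ)) - 2 * (d₁ : ℝ)) < (((d₁ : ℝ) + 2 * (d₂ : ℝ)) - (d₁ : ℝ)) ^ 2 :=
    ⟨by positivity, sub_pos.mp (by rw [show (((d₁ : ℝ) + 2 * (d₂ : ℝ)) - (d₁ : ℝ)) ^ 2 - ((d₁ : ℝ) + 2 * (d₂ : ℝ)) * (((d₁ : ℝ) + 2 * (d₂ : ℝ)) - 2 * (d₁ : ℝ)) = (d₁ : ℝ) ^ 2 by ring]; positivity)⟩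
  have q10 : 0 < ((d₁ : ℝ) + (d₂ : ℝ) + (d₃ : ℝ)) - 2 * (d₁ : ℝ) := by linarith
  have f10 : 0 < ((d₁ : ℝ) + (d₂ : ℝ) + (d₃ : ℝ)) * (((d₁ : ℝ) + (d₂ : ℝ) + (d₃ : ℝ)) - 2 * (d₁ : ℝ)) ∧ ((d₁ : ℝ) + (d₂ : ℝ) + (d₃ : ℝ)) * (((d₁ : ℝ) + (d₂ : ℝ) + (d₃ : ℝ)) - 2 * (d₁ : ℝ)) < (((d₁ : ℝ) + (d₂ : ℝ) + (d₃ : ℝ)) - (d₁ : ℝ)) ^ 2 :=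
    ⟨by positivity, sub_pos.mp (by rw [show (((d₁ : ℝ) + (d₂ : ℝ) + (d₃ : ℝ)) - (d₁ : ℝ)) ^ 2 - ((d₁ : ℝ) + (d₂ : ℝ) + (d₃ : ℝ)) * (((d₁ : ℝ) + (d₂ : ℝ) + (d₃ : ℝ)) - 2 * (d₁ : ℝ)) = (d₁ : ℝ) ^ 2 by ring]; positivity)⟩
  have q11 : 0 < ((d₁ : ℝ) + 2 * (d₃ : ℝ)) - 2 * (d₁ : ℝ) := by linarith
  have f11 : 0 < ((d₁ : ℝ) + 2 * (d₃ : ℝ)) * (((d₁ : ℝ) + 2 * (d₃ : ℝ)) - 2 * (d₁ : ℝ)) ∧ ((d₁ : ℝ) + 2 * (d₃ : ℝ)) * (((d₁ : ℝ) + 2 * (d₃ : ℝ)) - 2 * (d₁ : ℝ)) < (((d₁ : ℝ) + 2 * (d₃ : ℝ)) - (d₁ : ℝ)) ^ 2 :=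
    ⟨by positivity, sub_pos.mp (by rw [show (((d₁ : ℝ) + 2 * (d₃ : ℝ)) - (d₁ : ℝ)) ^ 2 - ((d₁ : ℝ) + 2 * (d₃ : ℝ)) * (((d₁ : ℝ) + 2 * (d₃ : ℝ)) - 2 * (d₁ : ℝ)) = (d₁ : ℝ) ^ 2 by ring]; positivity)⟩
  have q12 : 0 < 3 * (d₂ : ℝ) - 2 * (d₁ : ℝ) := by linarith
  have f12 : 0 < 3 * (d₂ : ℝ) * (3 * (d₂ : ℝ) - 2 * (d₁ : ℝ)) ∧ 3 * (d₂ : ℝ) * (3 * (d₂ : ℝ) - 2 * (d₁ : ℝ)) < (3 * (d₂ : ℝ) - (d₁ : ℝ)) ^ 2 :=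
    ⟨by positivity, sub_pos.mp (by rw [show (3 * (d₂ : ℝ) - (d₁ : ℝ)) ^ 2 - 3 * (d₂ : ℝ) * (3 * (d₂ : ℝ) - 2 * (d₁ : ℝ)) = (d₁ : ℝ) ^ 2 by ring]; positivity)⟩
  have q13 : 0 < (2 * (d₂ : ℝ) + (d₃ : ℝ)) - 2 * (d₁ : ℝ) := by linarith
  have f13 : 0 < (2 * (d₂ : ℝ) + (d₃ : ℝ)) * ((2 * (d₂ : ℝ) + (d₃ : ℝ)) - 2 * (d₁ : ℝ)) ∧ (2 * (d₂ : ℝ) + (d₃ : ℝ)) * ((2 * (d₂ : ℝ) + (d₃ : ℝ)) - 2 * (d₁ : ℝ)) < ((2 * (d₂ : ℝ) + (d₃ : ℝ)) - (d₁ : ℝ)) ^ 2 :=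
    ⟨by positivity, sub_pos.mp (by rw [show ((2 * (d₂ : ℝ) + (d₃ : ℝ)) - (d₁ : ℝ)) ^ 2 - (2 * (d₂ : ℝ) + (d₃ : ℝ)) * ((2 * (d₂ : ℝ) + (d₃ : ℝ)) - 2 * (d₁ : ℝ)) = (d₁ : ℝ) ^ 2 by ring]; positivity)⟩
  have q14 : 0 < ((d₂ : ℝ) + 2 * (d₃ : ℝ)) - 2 * (d₁ : ℝ) := by linarith
  have f14 : 0 < ((d₂ : ℝ) + 2 * (d₃ : ℝ)) * (((d₂ : ℝ) + 2 * (d₃ : ℝ)) - 2 * (d₁ : ℝ)) ∧ ((d₂ : ℝ) + 2 * (d₃ : ℝ)) * (((d₂ : ℝ) + 2 * (d₃ : ℝ)) - 2 * (d₁ : ℝ)) < (((d₂ : ℝ) + 2 * (d₃ : ℝ)) - (d₁ : ℝ)) ^ 2 :=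
    ⟨by positivity, sub_pos.mp (by rw [show (((d₂ : ℝ) + 2 * (d₃ : ℝ)) - (d₁ : ℝ)) ^ 2 - ((d₂ : ℝ) + 2 * (d₃ : ℝ)) * (((d₂ : ℝ) + 2 * (d₃ : ℝ)) - 2 * (d₁ : ℝ)) = (d₁ : ℝ) ^ 2 by ring]; positivity)⟩
  have q15 : 0 < 3 * (d₃ : ℝ) - 2 * (d₁ : ℝ) := by linarith
  have f15 : 0 < 3 * (d₃ : ℝ) * (3 * (d₃ : ℝ) - 2 * (d₁ : ℝ)) ∧ 3 * (d₃ : ℝ) * (3 * (d₃ : ℝ) - 2 * (d₁ : ℝ)) < (3 * (d₃ : ℝ) - (d₁ : ℝ)) ^ 2 :=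
    ⟨by positivity, sub_pos.mp (by rw [show (3 * (d₃ : ℝ) - (d₁ : ℝ)) ^ 2 - 3 * (d₃ : ℝ) * (3 * (d₃ : ℝ) - 2 * (d₁ : ℝ)) = (d₁ : ℝ) ^ 2 by ring]; positivity)⟩
  have g0 : ((d₂ : ℝ) * ((d₂ : ℝ) - 2 * (d₁ : ℝ))) < ((d₂ : ℝ) - (d₁ : ℝ)) ^ 2 := f0.2
  have g1 : ((d₂ : ℝ) * ((d₂ : ℝ) - 2 * (d₁ : ℝ))) * ((d₃ : ℝ) * ((d₃ : ℝ) - 2 * (d₁ : ℝ)))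
      < ((d₂ : ℝ) - (d₁ : ℝ)) ^ 2 * ((d₃ : ℝ) - (d₁ : ℝ)) ^ 2 :=
    mul_lt_mul'' g0 f1.2 (by positivity) f1.1.le
  have g2 : ((d₂ : ℝ) * ((d₂ : ℝ) - 2 * (d₁ : ℝ))) * ((d₃ : ℝ) * ((d₃ : ℝ) - 2 * (d₁ : ℝ))) * (((d₁ : ℝ) + (d₂ : ℝ)) * (((d₁ : ℝ) + (d₂ : ℝ)) - 2 * (d₁ : ℝ)))
      < ((d₂ : ℝ) - (d₁ : ℝ)) ^ 2 * ((d₃ : ℝ) - (d₁ : ℝ)) ^ 2 * (((d₁ : ℝ) + (d₂ : ℝ)) - (d₁ : ℝ)) ^ 2 :=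
    mul_lt_mul'' g1 f2.2 (by positivity) f2.1.le
  have g3 : ((d₂ : ℝ) * ((d₂ : ℝ) - 2 * (d₁ : ℝ))) * ((d₃ : ℝ) * ((d₃ : ℝ) - 2 * (d₁ : ℝ))) * (((d₁ : ℝ) + (d₂ : ℝ)) * (((d₁ : ℝ) + (d₂ : ℝ)) - 2
      * (d₁ : ℝ))) * (((d₁ : ℝ) + (d₃ : ℝ)) * (((d₁ : ℝ) + (d₃ : ℝ)) - 2 * (d₁ : ℝ)))
      < ((d₂ : ℝ) - (d₁ : ℝ)) ^ 2 * ((d₃ : ℝ) - (d₁ : ℝ)) ^ 2 * (((d₁ : ℝ) + (d₂ : ℝ)) - (d₁ : ℝ)) ^ 2 * (((d₁ : ℝ) + (d₃ : ℝ)) - (d₁ : ℝ)) ^ 2 :=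
    mul_lt_mul'' g2 f3.2 (by positivity) f3.1.le
  have g4 : ((d₂ : ℝ) * ((d₂ : ℝ) - 2 * (d₁ : ℝ))) * ((d₃ : ℝ) * ((d₃ : ℝ) - 2 * (d₁ : ℝ))) * (((d₁ : ℝ) + (d₂ : ℝ)) * (((d₁ : ℝ) + (d₂ : ℝ)) - 2
      * (d₁ : ℝ))) * (((d₁ : ℝ) + (d₃ : ℝ)) * (((d₁ : ℝ) + (d₃ : ℝ)) - 2 * (d₁ : ℝ))) * (2 * (d₂ : ℝ) * (2 * (d₂ : ℝ) - 2 * (d₁ : ℝ)))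
      < ((d₂ : ℝ) - (d₁ : ℝ)) ^ 2 * ((d₃ : ℝ) - (d₁ : ℝ)) ^ 2 * (((d₁ : ℝ) + (d₂ : ℝ)) - (d₁ : ℝ)) ^ 2 * (((d₁ : ℝ) + (d₃ : ℝ)) - (d₁ : ℝ)) ^ 2
          * (2 * (d₂ : ℝ) - (d₁ : ℝ)) ^ 2 :=
    mul_lt_mul'' g3 f4.2 (by positivity) f4.1.le
  have g5 : ((d₂ : ℝ) * ((d₂ : ℝ) - 2 * (d₁ : ℝ))) * ((d₃ : ℝ) * ((d₃ : ℝ) - 2 * (d₁ : ℝ))) * (((d₁ : ℝ) + (d₂ : ℝ)) * (((d₁ : ℝ) + (d₂ : ℝ)) - 2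
      * (d₁ : ℝ))) * (((d₁ : ℝ) + (d₃ : ℝ)) * (((d₁ : ℝ) + (d₃ : ℝ)) - 2 * (d₁ : ℝ))) * (2 * (d₂ : ℝ) * (2 * (d₂ : ℝ) - 2 * (d₁ : ℝ))) * (((d₂ : ℝ)
      + (d₃ : ℝ)) * (((d₂ : ℝ) + (d₃ : ℝ)) - 2 * (d₁ : ℝ)))
      < ((d₂ : ℝ) - (d₁ : ℝ)) ^ 2 * ((d₃ : ℝ) - (d₁ : ℝ)) ^ 2 * (((d₁ : ℝ) + (d₂ : ℝ)) - (d₁ : ℝ)) ^ 2 * (((d₁ : ℝ) + (d₃ : ℝ)) - (d₁ : ℝ)) ^ 2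
          * (2 * (d₂ : ℝ) - (d₁ : ℝ)) ^ 2 * (((d₂ : ℝ) + (d₃ : ℝ)) - (d₁ : ℝ)) ^ 2 :=
    mul_lt_mul'' g4 f5.2 (by positivity) f5.1.le
  have g6 : ((d₂ : ℝ) * ((d₂ : ℝ) - 2 * (d₁ : ℝ))) * ((d₃ : ℝ) * ((d₃ : ℝ) - 2 * (d₁ : ℝ))) * (((d₁ : ℝ) + (d₂ : ℝ)) * (((d₁ : ℝ) + (d₂ : ℝ)) - 2
      * (d₁ : ℝ))) * (((d₁ : ℝ) + (d₃ : ℝ)) * (((d₁ : ℝ) + (d₃ : ℝ)) - 2 * (d₁ : ℝ))) * (2 * (d₂ : ℝ) * (2 * (d₂ : ℝ) - 2 * (d₁ : ℝ))) * (((d₂ : ℝ)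
      + (d₃ : ℝ)) * (((d₂ : ℝ) + (d₃ : ℝ)) - 2 * (d₁ : ℝ))) * (2 * (d₃ : ℝ) * (2 * (d₃ : ℝ) - 2 * (d₁ : ℝ)))
      < ((d₂ : ℝ) - (d₁ : ℝ)) ^ 2 * ((d₃ : ℝ) - (d₁ : ℝ)) ^ 2 * (((d₁ : ℝ) + (d₂ : ℝ)) - (d₁ : ℝ)) ^ 2 * (((d₁ : ℝ) + (d₃ : ℝ)) - (d₁ : ℝ)) ^ 2
          * (2 * (d₂ : ℝ) - (d₁ : ℝ)) ^ 2 * (((d₂ : ℝ) + (d₃ : ℝ)) - (d₁ : ℝ)) ^ 2 * (2 * (d₃ : ℝ) - (d₁ : ℝ)) ^ 2 :=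
    mul_lt_mul'' g5 f6.2 (by positivity) f6.1.le
  have g7 : ((d₂ : ℝ) * ((d₂ : ℝ) - 2 * (d₁ : ℝ))) * ((d₃ : ℝ) * ((d₃ : ℝ) - 2 * (d₁ : ℝ))) * (((d₁ : ℝ) + (d₂ : ℝ)) * (((d₁ : ℝ) + (d₂ : ℝ)) - 2
      * (d₁ : ℝ))) * (((d₁ : ℝ) + (d₃ : ℝ)) * (((d₁ : ℝ) + (d₃ : ℝ)) - 2 * (d₁ : ℝ))) * (2 * (d₂ : ℝ) * (2 * (d₂ : ℝ) - 2 * (d₁ : ℝ))) * (((d₂ : ℝ)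
      + (d₃ : ℝ)) * (((d₂ : ℝ) + (d₃ : ℝ)) - 2 * (d₁ : ℝ))) * (2 * (d₃ : ℝ) * (2 * (d₃ : ℝ) - 2 * (d₁ : ℝ))) * ((2 * (d₁ : ℝ) + (d₂ : ℝ)) * ((2
      * (d₁ : ℝ) + (d₂ : ℝ)) - 2 * (d₁ : ℝ)))
      < ((d₂ : ℝ) - (d₁ : ℝ)) ^ 2 * ((d₃ : ℝ) - (d₁ : ℝ)) ^ 2 * (((d₁ : ℝ) + (d₂ : ℝ)) - (d₁ : ℝ)) ^ 2 * (((d₁ : ℝ) + (d₃ : ℝ)) - (d₁ : ℝ)) ^ 2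
          * (2 * (d₂ : ℝ) - (d₁ : ℝ)) ^ 2 * (((d₂ : ℝ) + (d₃ : ℝ)) - (d₁ : ℝ)) ^ 2 * (2 * (d₃ : ℝ) - (d₁ : ℝ)) ^ 2 * ((2 * (d₁ : ℝ) + (d₂ : ℝ))
          - (d₁ : ℝ)) ^ 2 :=
    mul_lt_mul'' g6 f7.2 (by positivity) f7.1.le
  have g8 : ((d₂ : ℝ) * ((d₂ : ℝ) - 2 * (d₁ : ℝ))) * ((d₃ : ℝ) * ((d₃ : ℝ) - 2 * (d₁ : ℝ))) * (((d₁ : ℝ) + (d₂ : ℝ)) * (((d₁ : ℝ) + (d₂ : ℝ)) - 2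
      * (d₁ : ℝ))) * (((d₁ : ℝ) + (d₃ : ℝ)) * (((d₁ : ℝ) + (d₃ : ℝ)) - 2 * (d₁ : ℝ))) * (2 * (d₂ : ℝ) * (2 * (d₂ : ℝ) - 2 * (d₁ : ℝ))) * (((d₂ : ℝ)
      + (d₃ : ℝ)) * (((d₂ : ℝ) + (d₃ : ℝ)) - 2 * (d₁ : ℝ))) * (2 * (d₃ : ℝ) * (2 * (d₃ : ℝ) - 2 * (d₁ : ℝ))) * ((2 * (d₁ : ℝ) + (d₂ : ℝ)) * ((2
      * (d₁ : ℝ) + (d₂ : ℝ)) - 2 * (d₁ : ℝ))) * ((2 * (d₁ : ℝ) + (d₃ : ℝ)) * ((2 * (d₁ : ℝ) + (d₃ : ℝ)) - 2 * (d₁ : ℝ)))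
      < ((d₂ : ℝ) - (d₁ : ℝ)) ^ 2 * ((d₃ : ℝ) - (d₁ : ℝ)) ^ 2 * (((d₁ : ℝ) + (d₂ : ℝ)) - (d₁ : ℝ)) ^ 2 * (((d₁ : ℝ) + (d₃ : ℝ)) - (d₁ : ℝ)) ^ 2
          * (2 * (d₂ : ℝ) - (d₁ : ℝ)) ^ 2 * (((d₂ : ℝ) + (d₃ : ℝ)) - (d₁ : ℝ)) ^ 2 * (2 * (d₃ : ℝ) - (d₁ : ℝ)) ^ 2 * ((2 * (d₁ : ℝ) + (d₂ : ℝ))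
          - (d₁ : ℝ)) ^ 2 * ((2 * (d₁ : ℝ) + (d₃ : ℝ)) - (d₁ : ℝ)) ^ 2 :=
    mul_lt_mul'' g7 f8.2 (by positivity) f8.1.le
  have g9 : ((d₂ : ℝ) * ((d₂ : ℝ) - 2 * (d₁ : ℝ))) * ((d₃ : ℝ) * ((d₃ : ℝ) - 2 * (d₁ : ℝ))) * (((d₁ : ℝ) + (d₂ : ℝ)) * (((d₁ : ℝ) + (d₂ : ℝ)) - 2
      * (d₁ : ℝ))) * (((d₁ : ℝ) + (d₃ : ℝ)) * (((d₁ : ℝ) + (d₃ : ℝ)) - 2 * (d₁ : ℝ))) * (2 * (d₂ : ℝ) * (2 * (d₂ : ℝ) - 2 * (d₁ : ℝ))) * (((d₂ : ℝ)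
      + (d₃ : ℝ)) * (((d₂ : ℝ) + (d₃ : ℝ)) - 2 * (d₁ : ℝ))) * (2 * (d₃ : ℝ) * (2 * (d₃ : ℝ) - 2 * (d₁ : ℝ))) * ((2 * (d₁ : ℝ) + (d₂ : ℝ)) * ((2
      * (d₁ : ℝ) + (d₂ : ℝ)) - 2 * (d₁ : ℝ))) * ((2 * (d₁ : ℝ) + (d₃ : ℝ)) * ((2 * (d₁ : ℝ) + (d₃ : ℝ)) - 2 * (d₁ : ℝ))) * (((d₁ : ℝ) + 2
      * (d₂ : ℝ)) * (((d₁ : ℝ) + 2 * (d₂ : ℝ)) - 2 * (d₁ : ℝ)))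
      < ((d₂ : ℝ) - (d₁ : ℝ)) ^ 2 * ((d₃ : ℝ) - (d₁ : ℝ)) ^ 2 * (((d₁ : ℝ) + (d₂ : ℝ)) - (d₁ : ℝ)) ^ 2 * (((d₁ : ℝ) + (d₃ : ℝ)) - (d₁ : ℝ)) ^ 2
          * (2 * (d₂ : ℝ) - (d₁ : ℝ)) ^ 2 * (((d₂ : ℝ) + (d₃ : ℝ)) - (d₁ : ℝ)) ^ 2 * (2 * (d₃ : ℝ) - (d₁ : ℝ)) ^ 2 * ((2 * (d₁ : ℝ) + (d₂ : ℝ))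
          - (d₁ : ℝ)) ^ 2 * ((2 * (d₁ : ℝ) + (d₃ : ℝ)) - (d₁ : ℝ)) ^ 2 * (((d₁ : ℝ) + 2 * (d₂ : ℝ)) - (d₁ : ℝ)) ^ 2 :=
    mul_lt_mul'' g8 f9.2 (by positivity) f9.1.le
  have g10 : ((d₂ : ℝ) * ((d₂ : ℝ) - 2 * (d₁ : ℝ))) * ((d₃ : ℝ) * ((d₃ : ℝ) - 2 * (d₁ : ℝ))) * (((d₁ : ℝ) + (d₂ : ℝ)) * (((d₁ : ℝ) + (d₂ : ℝ)) - 2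
      * (d₁ : ℝ))) * (((d₁ : ℝ) + (d₃ : ℝ)) * (((d₁ : ℝ) + (d₃ : ℝ)) - 2 * (d₁ : ℝ))) * (2 * (d₂ : ℝ) * (2 * (d₂ : ℝ) - 2 * (d₁ : ℝ))) * (((d₂ : ℝ)
      + (d₃ : ℝ)) * (((d₂ : ℝ) + (d₃ : ℝ)) - 2 * (d₁ : ℝ))) * (2 * (d₃ : ℝ) * (2 * (d₃ : ℝ) - 2 * (d₁ : ℝ))) * ((2 * (d₁ : ℝ) + (d₂ : ℝ)) * ((2
      * (d₁ : ℝ) + (d₂ : ℝ)) - 2 * (d₁ : ℝ))) * ((2 * (d₁ : ℝ) + (d₃ : ℝ)) * ((2 * (d₁ : ℝ) + (d₃ : ℝ)) - 2 * (d₁ : ℝ))) * (((d₁ : ℝ) + 2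
      * (d₂ : ℝ)) * (((d₁ : ℝ) + 2 * (d₂ : ℝ)) - 2 * (d₁ : ℝ))) * (((d₁ : ℝ) + (d₂ : ℝ) + (d₃ : ℝ)) * (((d₁ : ℝ) + (d₂ : ℝ) + (d₃ : ℝ)) - 2
      * (d₁ : ℝ)))
      < ((d₂ : ℝ) - (d₁ : ℝ)) ^ 2 * ((d₃ : ℝ) - (d₁ : ℝ)) ^ 2 * (((d₁ : ℝ) + (d₂ : ℝ)) - (d₁ : ℝ)) ^ 2 * (((d₁ : ℝ) + (d₃ : ℝ)) - (d₁ : ℝ)) ^ 2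
          * (2 * (d₂ : ℝ) - (d₁ : ℝ)) ^ 2 * (((d₂ : ℝ) + (d₃ : ℝ)) - (d₁ : ℝ)) ^ 2 * (2 * (d₃ : ℝ) - (d₁ : ℝ)) ^ 2 * ((2 * (d₁ : ℝ) + (d₂ : ℝ))
          - (d₁ : ℝ)) ^ 2 * ((2 * (d₁ : ℝ) + (d₃ : ℝ)) - (d₁ : ℝ)) ^ 2 * (((d₁ : ℝ) + 2 * (d₂ : ℝ)) - (d₁ : ℝ)) ^ 2 * (((d₁ : ℝ) + (d₂ : ℝ)
          + (d₃ : ℝ)) - (d₁ : ℝ)) ^ 2 :=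
    mul_lt_mul'' g9 f10.2 (by positivity) f10.1.le
  have g11 : ((d₂ : ℝ) * ((d₂ : ℝ) - 2 * (d₁ : ℝ))) * ((d₃ : ℝ) * ((d₃ : ℝ) - 2 * (d₁ : ℝ))) * (((d₁ : ℝ) + (d₂ : ℝ)) * (((d₁ : ℝ) + (d₂ : ℝ)) - 2
      * (d₁ : ℝ))) * (((d₁ : ℝ) + (d₃ : ℝ)) * (((d₁ : ℝ) + (d₃ : ℝ)) - 2 * (d₁ : ℝ))) * (2 * (d₂ : ℝ) * (2 * (d₂ : ℝ) - 2 * (d₁ : ℝ))) * (((d₂ : ℝ)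
      + (d₃ : ℝ)) * (((d₂ : ℝ) + (d₃ : ℝ)) - 2 * (d₁ : ℝ))) * (2 * (d₃ : ℝ) * (2 * (d₃ : ℝ) - 2 * (d₁ : ℝ))) * ((2 * (d₁ : ℝ) + (d₂ : ℝ)) * ((2
      * (d₁ : ℝ) + (d₂ : ℝ)) - 2 * (d₁ : ℝ))) * ((2 * (d₁ : ℝ) + (d₃ : ℝ)) * ((2 * (d₁ : ℝ) + (d₃ : ℝ)) - 2 * (d₁ : ℝ))) * (((d₁ : ℝ) + 2
      * (d₂ : ℝ)) * (((d₁ : ℝ) + 2 * (d₂ : ℝ)) - 2 * (d₁ : ℝ))) * (((d₁ : ℝ) + (d₂ : ℝ) + (d₃ : ℝ)) * (((d₁ : ℝ) + (d₂ : ℝ) + (d₃ : ℝ)) - 2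
      * (d₁ : ℝ))) * (((d₁ : ℝ) + 2 * (d₃ : ℝ)) * (((d₁ : ℝ) + 2 * (d₃ : ℝ)) - 2 * (d₁ : ℝ)))
      < ((d₂ : ℝ) - (d₁ : ℝ)) ^ 2 * ((d₃ : ℝ) - (d₁ : ℝ)) ^ 2 * (((d₁ : ℝ) + (d₂ : ℝ)) - (d₁ : ℝ)) ^ 2 * (((d₁ : ℝ) + (d₃ : ℝ)) - (d₁ : ℝ)) ^ 2
          * (2 * (d₂ : ℝ) - (d₁ : ℝ)) ^ 2 * (((d₂ : ℝ) + (d₃ : ℝ)) - (d₁ : ℝ)) ^ 2 * (2 * (d₃ : ℝ) - (d₁ : ℝ)) ^ 2 * ((2 * (d₁ : ℝ) + (d₂ : ℝ))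
          - (d₁ : ℝ)) ^ 2 * ((2 * (d₁ : ℝ) + (d₃ : ℝ)) - (d₁ : ℝ)) ^ 2 * (((d₁ : ℝ) + 2 * (d₂ : ℝ)) - (d₁ : ℝ)) ^ 2 * (((d₁ : ℝ) + (d₂ : ℝ)
          + (d₃ : ℝ)) - (d₁ : ℝ)) ^ 2 * (((d₁ : ℝ) + 2 * (d₃ : ℝ)) - (d₁ : ℝ)) ^ 2 :=
    mul_lt_mul'' g10 f11.2 (by positivity) f11.1.le
  have g12 : ((d₂ : ℝ) * ((d₂ : ℝ) - 2 * (d₁ : ℝ))) * ((d₃ : ℝ) * ((d₃ : ℝ) - 2 * (d₁ : ℝ))) * (((d₁ : ℝ) + (d₂ : ℝ)) * (((d₁ : ℝ) + (d₂ : ℝ)) - 2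
      * (d₁ : ℝ))) * (((d₁ : ℝ) + (d₃ : ℝ)) * (((d₁ : ℝ) + (d₃ : ℝ)) - 2 * (d₁ : ℝ))) * (2 * (d₂ : ℝ) * (2 * (d₂ : ℝ) - 2 * (d₁ : ℝ))) * (((d₂ : ℝ)
      + (d₃ : ℝ)) * (((d₂ : ℝ) + (d₃ : ℝ)) - 2 * (d₁ : ℝ))) * (2 * (d₃ : ℝ) * (2 * (d₃ : ℝ) - 2 * (d₁ : ℝ))) * ((2 * (d₁ : ℝ) + (d₂ : ℝ)) * ((2
      * (d₁ : ℝ) + (d₂ : ℝ)) - 2 * (d₁ : ℝ))) * ((2 * (d₁ : ℝ) + (d₃ : ℝ)) * ((2 * (d₁ : ℝ) + (d₃ : ℝ)) - 2 * (d₁ : ℝ))) * (((d₁ : ℝ) + 2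
      * (d₂ : ℝ)) * (((d₁ : ℝ) + 2 * (d₂ : ℝ)) - 2 * (d₁ : ℝ))) * (((d₁ : ℝ) + (d₂ : ℝ) + (d₃ : ℝ)) * (((d₁ : ℝ) + (d₂ : ℝ) + (d₃ : ℝ)) - 2
      * (d₁ : ℝ))) * (((d₁ : ℝ) + 2 * (d₃ : ℝ)) * (((d₁ : ℝ) + 2 * (d₃ : ℝ)) - 2 * (d₁ : ℝ))) * (3 * (d₂ : ℝ) * (3 * (d₂ : ℝ) - 2 * (d₁ : ℝ)))
      < ((d₂ : ℝ) - (d₁ : ℝ)) ^ 2 * ((d₃ : ℝ) - (d₁ : ℝ)) ^ 2 * (((d₁ : ℝ) + (d₂ : ℝ)) - (d₁ : ℝ)) ^ 2 * (((d₁ : ℝ) + (d₃ : ℝ)) - (d₁ : ℝ)) ^ 2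
          * (2 * (d₂ : ℝ) - (d₁ : ℝ)) ^ 2 * (((d₂ : ℝ) + (d₃ : ℝ)) - (d₁ : ℝ)) ^ 2 * (2 * (d₃ : ℝ) - (d₁ : ℝ)) ^ 2 * ((2 * (d₁ : ℝ) + (d₂ : ℝ))
          - (d₁ : ℝ)) ^ 2 * ((2 * (d₁ : ℝ) + (d₃ : ℝ)) - (d₁ : ℝ)) ^ 2 * (((d₁ : ℝ) + 2 * (d₂ : ℝ)) - (d₁ : ℝ)) ^ 2 * (((d₁ : ℝ) + (d₂ : ℝ)
          + (d₃ : ℝ)) - (d₁ : ℝ)) ^ 2 * (((d₁ : ℝ) + 2 * (d₃ : ℝ)) - (d₁ : ℝ)) ^ 2 * (3 * (d₂ : ℝ) - (d₁ : ℝ)) ^ 2 :=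
    mul_lt_mul'' g11 f12.2 (by positivity) f12.1.le
  have g13 : ((d₂ : ℝ) * ((d₂ : ℝ) - 2 * (d₁ : ℝ))) * ((d₃ : ℝ) * ((d₃ : ℝ) - 2 * (d₁ : ℝ))) * (((d₁ : ℝ) + (d₂ : ℝ)) * (((d₁ : ℝ) + (d₂ : ℝ)) - 2
      * (d₁ : ℝ))) * (((d₁ : ℝ) + (d₃ : ℝ)) * (((d₁ : ℝ) + (d₃ : ℝ)) - 2 * (d₁ : ℝ))) * (2 * (d₂ : ℝ) * (2 * (d₂ : ℝ) - 2 * (d₁ : ℝ))) * (((d₂ : ℝ)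
      + (d₃ : ℝ)) * (((d₂ : ℝ) + (d₃ : ℝ)) - 2 * (d₁ : ℝ))) * (2 * (d₃ : ℝ) * (2 * (d₃ : ℝ) - 2 * (d₁ : ℝ))) * ((2 * (d₁ : ℝ) + (d₂ : ℝ)) * ((2
      * (d₁ : ℝ) + (d₂ : ℝ)) - 2 * (d₁ : ℝ))) * ((2 * (d₁ : ℝ) + (d₃ : ℝ)) * ((2 * (d₁ : ℝ) + (d₃ : ℝ)) - 2 * (d₁ : ℝ))) * (((d₁ : ℝ) + 2
      * (d₂ : ℝ)) * (((d₁ : ℝ) + 2 * (d₂ : ℝ)) - 2 * (d₁ : ℝ))) * (((d₁ : ℝ) + (d₂ : ℝ) + (d₃ : ℝ)) * (((d₁ : ℝ) + (d₂ : ℝ) + (d₃ : ℝ)) - 2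
      * (d₁ : ℝ))) * (((d₁ : ℝ) + 2 * (d₃ : ℝ)) * (((d₁ : ℝ) + 2 * (d₃ : ℝ)) - 2 * (d₁ : ℝ))) * (3 * (d₂ : ℝ) * (3 * (d₂ : ℝ) - 2 * (d₁ : ℝ)))
      * ((2 * (d₂ : ℝ) + (d₃ : ℝ)) * ((2 * (d₂ : ℝ) + (d₃ : ℝ)) - 2 * (d₁ : ℝ)))
      < ((d₂ : ℝ) - (d₁ : ℝ)) ^ 2 * ((d₃ : ℝ) - (d₁ : ℝ)) ^ 2 * (((d₁ : ℝ) + (d₂ : ℝ)) - (d₁ : ℝ)) ^ 2 * (((d₁ : ℝ) + (d₃ : ℝ)) - (d₁ : ℝ)) ^ 2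
          * (2 * (d₂ : ℝ) - (d₁ : ℝ)) ^ 2 * (((d₂ : ℝ) + (d₃ : ℝ)) - (d₁ : ℝ)) ^ 2 * (2 * (d₃ : ℝ) - (d₁ : ℝ)) ^ 2 * ((2 * (d₁ : ℝ) + (d₂ : ℝ))
          - (d₁ : ℝ)) ^ 2 * ((2 * (d₁ : ℝ) + (d₃ : ℝ)) - (d₁ : ℝ)) ^ 2 * (((d₁ : ℝ) + 2 * (d₂ : ℝ)) - (d₁ : ℝ)) ^ 2 * (((d₁ : ℝ) + (d₂ : ℝ)
          + (d₃ : ℝ)) - (d₁ : ℝ)) ^ 2 * (((d₁ : ℝ) + 2 * (d₃ : ℝ)) - (d₁ : ℝ)) ^ 2 * (3 * (d₂ : ℝ) - (d₁ : ℝ)) ^ 2 * ((2 * (d₂ : ℝ) + (d₃ : ℝ))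
          - (d₁ : ℝ)) ^ 2 :=
    mul_lt_mul'' g12 f13.2 (by positivity) f13.1.le
  have g14 : ((d₂ : ℝ) * ((d₂ : ℝ) - 2 * (d₁ : ℝ))) * ((d₃ : ℝ) * ((d₃ : ℝ) - 2 * (d₁ : ℝ))) * (((d₁ : ℝ) + (d₂ : ℝ)) * (((d₁ : ℝ) + (d₂ : ℝ)) - 2
      * (d₁ : ℝ))) * (((d₁ : ℝ) + (d₃ : ℝ)) * (((d₁ : ℝ) + (d₃ : ℝ)) - 2 * (d₁ : ℝ))) * (2 * (d₂ : ℝ) * (2 * (d₂ : ℝ) - 2 * (d₁ : ℝ))) * (((d₂ : ℝ)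
      + (d₃ : ℝ)) * (((d₂ : ℝ) + (d₃ : ℝ)) - 2 * (d₁ : ℝ))) * (2 * (d₃ : ℝ) * (2 * (d₃ : ℝ) - 2 * (d₁ : ℝ))) * ((2 * (d₁ : ℝ) + (d₂ : ℝ)) * ((2
      * (d₁ : ℝ) + (d₂ : ℝ)) - 2 * (d₁ : ℝ))) * ((2 * (d₁ : ℝ) + (d₃ : ℝ)) * ((2 * (d₁ : ℝ) + (d₃ : ℝ)) - 2 * (d₁ : ℝ))) * (((d₁ : ℝ) + 2
      * (d₂ : ℝ)) * (((d₁ : ℝ) + 2 * (d₂ : ℝ)) - 2 * (d₁ : ℝ))) * (((d₁ : ℝ) + (d₂ : ℝ) + (d₃ : ℝ)) * (((d₁ : ℝ) + (d₂ : ℝ) + (d₃ : ℝ)) - 2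
      * (d₁ : ℝ))) * (((d₁ : ℝ) + 2 * (d₃ : ℝ)) * (((d₁ : ℝ) + 2 * (d₃ : ℝ)) - 2 * (d₁ : ℝ))) * (3 * (d₂ : ℝ) * (3 * (d₂ : ℝ) - 2 * (d₁ : ℝ)))
      * ((2 * (d₂ : ℝ) + (d₃ : ℝ)) * ((2 * (d₂ : ℝ) + (d₃ : ℝ)) - 2 * (d₁ : ℝ))) * (((d₂ : ℝ) + 2 * (d₃ : ℝ)) * (((d₂ : ℝ) + 2 * (d₃ : ℝ)) - 2
      * (d₁ : ℝ)))
      < ((d₂ : ℝ) - (d₁ : ℝ)) ^ 2 * ((d₃ : ℝ) - (d₁ : ℝ)) ^ 2 * (((d₁ : ℝ) + (d₂ : ℝ)) - (d₁ : ℝ)) ^ 2 * (((d₁ : ℝ) + (d₃ : ℝ)) - (d₁ : ℝ)) ^ 2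
          * (2 * (d₂ : ℝ) - (d₁ : ℝ)) ^ 2 * (((d₂ : ℝ) + (d₃ : ℝ)) - (d₁ : ℝ)) ^ 2 * (2 * (d₃ : ℝ) - (d₁ : ℝ)) ^ 2 * ((2 * (d₁ : ℝ) + (d₂ : ℝ))
          - (d₁ : ℝ)) ^ 2 * ((2 * (d₁ : ℝ) + (d₃ : ℝ)) - (d₁ : ℝ)) ^ 2 * (((d₁ : ℝ) + 2 * (d₂ : ℝ)) - (d₁ : ℝ)) ^ 2 * (((d₁ : ℝ) + (d₂ : ℝ)
          + (d₃ : ℝ)) - (d₁ : ℝ)) ^ 2 * (((d₁ : ℝ) + 2 * (d₃ : ℝ)) - (d₁ : ℝ)) ^ 2 * (3 * (d₂ : ℝ) - (d₁ : ℝ)) ^ 2 * ((2 * (d₂ : ℝ) + (d₃ : ℝ))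
          - (d₁ : ℝ)) ^ 2 * (((d₂ : ℝ) + 2 * (d₃ : ℝ)) - (d₁ : ℝ)) ^ 2 :=
    mul_lt_mul'' g13 f14.2 (by positivity) f14.1.le
  have g15 : ((d₂ : ℝ) * ((d₂ : ℝ) - 2 * (d₁ : ℝ))) * ((d₃ : ℝ) * ((d₃ : ℝ) - 2 * (d₁ : ℝ))) * (((d₁ : ℝ) + (d₂ : ℝ)) * (((d₁ : ℝ) + (d₂ : ℝ)) - 2
      * (d₁ : ℝ))) * (((d₁ : ℝ) + (d₃ : ℝ)) * (((d₁ : ℝ) + (d₃ : ℝ)) - 2 * (d₁ : ℝ))) * (2 * (d₂ : ℝ) * (2 * (d₂ : ℝ) - 2 * (d₁ : ℝ))) * (((d₂ : ℝ)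
      + (d₃ : ℝ)) * (((d₂ : ℝ) + (d₃ : ℝ)) - 2 * (d₁ : ℝ))) * (2 * (d₃ : ℝ) * (2 * (d₃ : ℝ) - 2 * (d₁ : ℝ))) * ((2 * (d₁ : ℝ) + (d₂ : ℝ)) * ((2
      * (d₁ : ℝ) + (d₂ : ℝ)) - 2 * (d₁ : ℝ))) * ((2 * (d₁ : ℝ) + (d₃ : ℝ)) * ((2 * (d₁ : ℝ) + (d₃ : ℝ)) - 2 * (d₁ : ℝ))) * (((d₁ : ℝ) + 2
      * (d₂ : ℝ)) * (((d₁ : ℝ) + 2 * (d₂ : ℝ)) - 2 * (d₁ : ℝ))) * (((d₁ : ℝ) + (d₂ : ℝ) + (d₃ : ℝ)) * (((d₁ : ℝ) + (d₂ : ℝ) + (d₃ : ℝ)) - 2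
      * (d₁ : ℝ))) * (((d₁ : ℝ) + 2 * (d₃ : ℝ)) * (((d₁ : ℝ) + 2 * (d₃ : ℝ)) - 2 * (d₁ : ℝ))) * (3 * (d₂ : ℝ) * (3 * (d₂ : ℝ) - 2 * (d₁ : ℝ)))
      * ((2 * (d₂ : ℝ) + (d₃ : ℝ)) * ((2 * (d₂ : ℝ) + (d₃ : ℝ)) - 2 * (d₁ : ℝ))) * (((d₂ : ℝ) + 2 * (d₃ : ℝ)) * (((d₂ : ℝ) + 2 * (d₃ : ℝ)) - 2
      * (d₁ : ℝ))) * (3 * (d₃ : ℝ) * (3 * (d₃ : ℝ) - 2 * (d₁ : ℝ)))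
      < ((d₂ : ℝ) - (d₁ : ℝ)) ^ 2 * ((d₃ : ℝ) - (d₁ : ℝ)) ^ 2 * (((d₁ : ℝ) + (d₂ : ℝ)) - (d₁ : ℝ)) ^ 2 * (((d₁ : ℝ) + (d₃ : ℝ)) - (d₁ : ℝ)) ^ 2
          * (2 * (d₂ : ℝ) - (d₁ : ℝ)) ^ 2 * (((d₂ : ℝ) + (d₃ : ℝ)) - (d₁ : ℝ)) ^ 2 * (2 * (d₃ : ℝ) - (d₁ : ℝ)) ^ 2 * ((2 * (d₁ : ℝ) + (d₂ : ℝ))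
          - (d₁ : ℝ)) ^ 2 * ((2 * (d₁ : ℝ) + (d₃ : ℝ)) - (d₁ : ℝ)) ^ 2 * (((d₁ : ℝ) + 2 * (d₂ : ℝ)) - (d₁ : ℝ)) ^ 2 * (((d₁ : ℝ) + (d₂ : ℝ)
          + (d₃ : ℝ)) - (d₁ : ℝ)) ^ 2 * (((d₁ : ℝ) + 2 * (d₃ : ℝ)) - (d₁ : ℝ)) ^ 2 * (3 * (d₂ : ℝ) - (d₁ : ℝ)) ^ 2 * ((2 * (d₂ : ℝ) + (d₃ : ℝ))
          - (d₁ : ℝ)) ^ 2 * (((d₂ : ℝ) + 2 * (d₃ : ℝ)) - (d₁ : ℝ)) ^ 2 * (3 * (d₃ : ℝ) - (d₁ : ℝ)) ^ 2 :=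
    mul_lt_mul'' g14 f15.2 (by positivity) f15.1.le
  -- positivity of the three products
  have hPe : 0 < (d₂ : ℝ) * (d₃ : ℝ) * ((d₁ : ℝ) + (d₂ : ℝ)) * ((d₁ : ℝ) + (d₃ : ℝ)) * 2 * (d₂ : ℝ) * ((d₂ : ℝ) + (d₃ : ℝ)) * 2 * (d₃ : ℝ) * (2
      * (d₁ : ℝ) + (d₂ : ℝ)) * (2 * (d₁ : ℝ) + (d₃ : ℝ)) * ((d₁ : ℝ) + 2 * (d₂ : ℝ)) * ((d₁ : ℝ) + (d₂ : ℝ) + (d₃ : ℝ)) * ((d₁ : ℝ) + 2 * (d₃ : ℝ))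
      * 3 * (d₂ : ℝ) * (2 * (d₂ : ℝ) + (d₃ : ℝ)) * ((d₂ : ℝ) + 2 * (d₃ : ℝ)) * 3 * (d₃ : ℝ) := by positivity
  have hP1 : 0 < ((d₂ : ℝ) - (d₁ : ℝ)) * ((d₃ : ℝ) - (d₁ : ℝ)) * (((d₁ : ℝ) + (d₂ : ℝ)) - (d₁ : ℝ)) * (((d₁ : ℝ) + (d₃ : ℝ)) - (d₁ : ℝ)) * (2
      * (d₂ : ℝ) - (d₁ : ℝ)) * (((d₂ : ℝ) + (d₃ : ℝ)) - (d₁ : ℝ)) * (2 * (d₃ : ℝ) - (d₁ : ℝ)) * ((2 * (d₁ : ℝ) + (d₂ : ℝ)) - (d₁ : ℝ)) * ((2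
      * (d₁ : ℝ) + (d₃ : ℝ)) - (d₁ : ℝ)) * (((d₁ : ℝ) + 2 * (d₂ : ℝ)) - (d₁ : ℝ)) * (((d₁ : ℝ) + (d₂ : ℝ) + (d₃ : ℝ)) - (d₁ : ℝ)) * (((d₁ : ℝ) + 2
      * (d₃ : ℝ)) - (d₁ : ℝ)) * (3 * (d₂ : ℝ) - (d₁ : ℝ)) * ((2 * (d₂ : ℝ) + (d₃ : ℝ)) - (d₁ : ℝ)) * (((d₂ : ℝ) + 2 * (d₃ : ℝ)) - (d₁ : ℝ)) * (3
      * (d₃ : ℝ) - (d₁ : ℝ)) := by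
    have r0 : 0 < (d₂ : ℝ) - (d₁ : ℝ) := by linarith
    have r1 : 0 < (d₃ : ℝ) - (d₁ : ℝ) := by linarith
    have r2 : 0 < ((d₁ : ℝ) + (d₂ : ℝ)) - (d₁ : ℝ) := by linarith
    have r3 : 0 < ((d₁ : ℝ) + (d₃ : ℝ)) - (d₁ : ℝ) := by linarith
    have r4 : 0 < 2 * (d₂ : ℝ) - (d₁ : ℝ) := by linarith
    have r5 : 0 < ((d₂ : ℝ) + (d₃ : ℝ)) - (d₁ : ℝ) := by linarith
    have r6 : 0 < 2 * (d₃ : ℝ) - (d₁ : ℝ) := by linarith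
    have r7 : 0 < (2 * (d₁ : ℝ) + (d₂ : ℝ)) - (d₁ : ℝ) := by linarith
    have r8 : 0 < (2 * (d₁ : ℝ) + (d₃ : ℝ)) - (d₁ : ℝ) := by linarith
    have r9 : 0 < ((d₁ : ℝ) + 2 * (d₂ : ℝ)) - (d₁ : ℝ) := by linarith
    have r10 : 0 < ((d₁ : ℝ) + (d₂ : ℝ) + (d₃ : ℝ)) - (d₁ : ℝ) := by linarith
    have r11 : 0 < ((d₁ : ℝ) + 2 * (d₃ : ℝ)) - (d₁ : ℝ) := by linarith
    have r12 : 0 < 3 * (d₂ : ℝ) - (d₁ : ℝ) := by linarith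
    have r13 : 0 < (2 * (d₂ : ℝ) + (d₃ : ℝ)) - (d₁ : ℝ) := by linarith
    have r14 : 0 < ((d₂ : ℝ) + 2 * (d₃ : ℝ)) - (d₁ : ℝ) := by linarith
    have r15 : 0 < 3 * (d₃ : ℝ) - (d₁ : ℝ) := by linarith
    positivity
  have hP2 : 0 < ((d₂ : ℝ) - 2 * (d₁ : ℝ)) * ((d₃ : ℝ) - 2 * (d₁ : ℝ)) * (((d₁ : ℝ) + (d₂ : ℝ)) - 2 * (d₁ : ℝ)) * (((d₁ : ℝ) + (d₃ : ℝ)) - 2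
      * (d₁ : ℝ)) * (2 * (d₂ : ℝ) - 2 * (d₁ : ℝ)) * (((d₂ : ℝ) + (d₃ : ℝ)) - 2 * (d₁ : ℝ)) * (2 * (d₃ : ℝ) - 2 * (d₁ : ℝ)) * ((2 * (d₁ : ℝ)
      + (d₂ : ℝ)) - 2 * (d₁ : ℝ)) * ((2 * (d₁ : ℝ) + (d₃ : ℝ)) - 2 * (d₁ : ℝ)) * (((d₁ : ℝ) + 2 * (d₂ : ℝ)) - 2 * (d₁ : ℝ)) * (((d₁ : ℝ) + (d₂ : ℝ)
      + (d₃ : ℝ)) - 2 * (d₁ : ℝ)) * (((d₁ : ℝ) + 2 * (d₃ : ℝ)) - 2 * (d₁ : ℝ)) * (3 * (d₂ : ℝ) - 2 * (d₁ : ℝ)) * ((2 * (d₂ : ℝ) + (d₃ : ℝ)) - 2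
      * (d₁ : ℝ)) * (((d₂ : ℝ) + 2 * (d₃ : ℝ)) - 2 * (d₁ : ℝ)) * (3 * (d₃ : ℝ) - 2 * (d₁ : ℝ)) := by
    positivity
  have hT : (x₀ ^ d₁ • S₁).IsSymm := hS₁.smul _
  set T : Matrix (Fin 3) (Fin 3) ℝ := (x₀ ^ d₁ • S₁) with hT_def
  -- the two confluent relations at the exponents d₁ and 2d₁
  have C1 : 6 * (d₁ : ℝ) ^ 2 * ((d₂ : ℝ) * (d₃ : ℝ) * ((d₁ : ℝ) + (d₂ : ℝ)) * ((d₁ : ℝ) + (d₃ : ℝ)) * 2 * (d₂ : ℝ) * ((d₂ : ℝ) + (d₃ : ℝ)) * 2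
      * (d₃ : ℝ) * (2 * (d₁ : ℝ) + (d₂ : ℝ)) * (2 * (d₁ : ℝ) + (d₃ : ℝ)) * ((d₁ : ℝ) + 2 * (d₂ : ℝ)) * ((d₁ : ℝ) + (d₂ : ℝ) + (d₃ : ℝ)) * ((d₁ : ℝ)
      + 2 * (d₃ : ℝ)) * 3 * (d₂ : ℝ) * (2 * (d₂ : ℝ) + (d₃ : ℝ)) * ((d₂ : ℝ) + 2 * (d₃ : ℝ)) * 3 * (d₃ : ℝ)) + T.trace * (2 * (d₁ : ℝ) ^ 2
      * (((d₂ : ℝ) - (d₁ : ℝ)) * ((d₃ : ℝ) - (d₁ : ℝ)) * (((d₁ : ℝ) + (d₂ : ℝ)) - (d₁ : ℝ)) * (((d₁ : ℝ) + (d₃ : ℝ)) - (d₁ : ℝ)) * (2 * (d₂ : ℝ)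
      - (d₁ : ℝ)) * (((d₂ : ℝ) + (d₃ : ℝ)) - (d₁ : ℝ)) * (2 * (d₃ : ℝ) - (d₁ : ℝ)) * ((2 * (d₁ : ℝ) + (d₂ : ℝ)) - (d₁ : ℝ)) * ((2 * (d₁ : ℝ)
      + (d₃ : ℝ)) - (d₁ : ℝ)) * (((d₁ : ℝ) + 2 * (d₂ : ℝ)) - (d₁ : ℝ)) * (((d₁ : ℝ) + (d₂ : ℝ) + (d₃ : ℝ)) - (d₁ : ℝ)) * (((d₁ : ℝ) + 2 * (d₃ : ℝ))
      - (d₁ : ℝ)) * (3 * (d₂ : ℝ) - (d₁ : ℝ)) * ((2 * (d₂ : ℝ) + (d₃ : ℝ)) - (d₁ : ℝ)) * (((d₂ : ℝ) + 2 * (d₃ : ℝ)) - (d₁ : ℝ)) * (3 * (d₃ : ℝ)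
      - (d₁ : ℝ)))) = 0 := by
    have hh := two_point_relation' (Finset.univ : Finset (Fin 20)) _ _ h hcard (i₀ := 0) (i := 1)
      (Finset.mem_univ _) (Finset.mem_univ _) (by decide)
    convert hh using 2 <;> simp [Fin.prod_univ_succ, -mul_eq_mul_left_iff, -mul_eq_mul_right_iff] <;> ring
  have C2 : 3 * (d₁ : ℝ) ^ 2 * ((d₂ : ℝ) * (d₃ : ℝ) * ((d₁ : ℝ) + (d₂ : ℝ)) * ((d₁ : ℝ) + (d₃ : ℝ)) * 2 * (d₂ : ℝ) * ((d₂ : ℝ) + (d₃ : ℝ)) * 2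
      * (d₃ : ℝ) * (2 * (d₁ : ℝ) + (d₂ : ℝ)) * (2 * (d₁ : ℝ) + (d₃ : ℝ)) * ((d₁ : ℝ) + 2 * (d₂ : ℝ)) * ((d₁ : ℝ) + (d₂ : ℝ) + (d₃ : ℝ)) * ((d₁ : ℝ)
      + 2 * (d₃ : ℝ)) * 3 * (d₂ : ℝ) * (2 * (d₂ : ℝ) + (d₃ : ℝ)) * ((d₂ : ℝ) + 2 * (d₃ : ℝ)) * 3 * (d₃ : ℝ)) - (T 0 0 * T 1 1 - T 0 1 * T 1 0
      + (T 0 0 * T 2 2 - T 0 2 * T 2 0) + (T 1 1 * T 2 2 - T 1 2 * T 2 1)) * ((d₁ : ℝ) ^ 2 * (((d₂ : ℝ) - 2 * (d₁ : ℝ)) * ((d₃ : ℝ) - 2 * (d₁ : ℝ))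
      * (((d₁ : ℝ) + (d₂ : ℝ)) - 2 * (d₁ : ℝ)) * (((d₁ : ℝ) + (d₃ : ℝ)) - 2 * (d₁ : ℝ)) * (2 * (d₂ : ℝ) - 2 * (d₁ : ℝ)) * (((d₂ : ℝ) + (d₃ : ℝ))
      - 2 * (d₁ : ℝ)) * (2 * (d₃ : ℝ) - 2 * (d₁ : ℝ)) * ((2 * (d₁ : ℝ) + (d₂ : ℝ)) - 2 * (d₁ : ℝ)) * ((2 * (d₁ : ℝ) + (d₃ : ℝ)) - 2 * (d₁ : ℝ))
      * (((d₁ : ℝ) + 2 * (d₂ : ℝ)) - 2 * (d₁ : ℝ)) * (((d₁ : ℝ) + (d₂ : ℝ) + (d₃ : ℝ)) - 2 * (d₁ : ℝ)) * (((d₁ : ℝ) + 2 * (d₃ : ℝ)) - 2 * (d₁ : ℝ))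
      * (3 * (d₂ : ℝ) - 2 * (d₁ : ℝ)) * ((2 * (d₂ : ℝ) + (d₃ : ℝ)) - 2 * (d₁ : ℝ)) * (((d₂ : ℝ) + 2 * (d₃ : ℝ)) - 2 * (d₁ : ℝ)) * (3 * (d₃ : ℝ) - 2
      * (d₁ : ℝ)))) = 0 := by
    have hh := two_point_relation' (Finset.univ : Finset (Fin 20)) _ _ h hcard (i₀ := 0) (i := 4)
      (Finset.mem_univ _) (Finset.mem_univ _) (by decide)
    convert hh using 2
    all_goals (simp [Fin.prod_univ_succ, -mul_eq_mul_left_iff, -mul_eq_mul_right_iff]; ring)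
  -- Newton's inequality for the symmetric letter
  have hsos := three_e2_le_trace_sq_of_isSymm T hT
  obtain ⟨Pe, hPe_def⟩ : ∃ P : ℝ, P = (d₂ : ℝ) * (d₃ : ℝ) * ((d₁ : ℝ) + (d₂ : ℝ)) * ((d₁ : ℝ) + (d₃ : ℝ)) * 2 * (d₂ : ℝ) * ((d₂ : ℝ) + (d₃ : ℝ))
      * 2 * (d₃ : ℝ) * (2 * (d₁ : ℝ) + (d₂ : ℝ)) * (2 * (d₁ : ℝ) + (d₃ : ℝ)) * ((d₁ : ℝ) + 2 * (d₂ : ℝ)) * ((d₁ : ℝ) + (d₂ : ℝ) + (d₃ : ℝ))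
      * ((d₁ : ℝ) + 2 * (d₃ : ℝ)) * 3 * (d₂ : ℝ) * (2 * (d₂ : ℝ) + (d₃ : ℝ)) * ((d₂ : ℝ) + 2 * (d₃ : ℝ)) * 3 * (d₃ : ℝ) := ⟨_, rfl⟩
  obtain ⟨P₁, hP1_def⟩ : ∃ P : ℝ, P = ((d₂ : ℝ) - (d₁ : ℝ)) * ((d₃ : ℝ) - (d₁ : ℝ)) * (((d₁ : ℝ) + (d₂ : ℝ)) - (d₁ : ℝ)) * (((d₁ : ℝ) + (d₃ : ℝ))
      - (d₁ : ℝ)) * (2 * (d₂ : ℝ) - (d₁ : ℝ)) * (((d₂ : ℝ) + (d₃ : ℝ)) - (d₁ : ℝ)) * (2 * (d₃ : ℝ) - (d₁ : ℝ)) * ((2 * (d₁ : ℝ) + (d₂ : ℝ))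
      - (d₁ : ℝ)) * ((2 * (d₁ : ℝ) + (d₃ : ℝ)) - (d₁ : ℝ)) * (((d₁ : ℝ) + 2 * (d₂ : ℝ)) - (d₁ : ℝ)) * (((d₁ : ℝ) + (d₂ : ℝ) + (d₃ : ℝ)) - (d₁ : ℝ))
      * (((d₁ : ℝ) + 2 * (d₃ : ℝ)) - (d₁ : ℝ)) * (3 * (d₂ : ℝ) - (d₁ : ℝ)) * ((2 * (d₂ : ℝ) + (d₃ : ℝ)) - (d₁ : ℝ)) * (((d₂ : ℝ) + 2 * (d₃ : ℝ))
      - (d₁ : ℝ)) * (3 * (d₃ : ℝ) - (d₁ : ℝ)) := ⟨_, rfl⟩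
  obtain ⟨P₂, hP2_def⟩ : ∃ P : ℝ, P = ((d₂ : ℝ) - 2 * (d₁ : ℝ)) * ((d₃ : ℝ) - 2 * (d₁ : ℝ)) * (((d₁ : ℝ) + (d₂ : ℝ)) - 2 * (d₁ : ℝ)) * (((d₁ : ℝ)
      + (d₃ : ℝ)) - 2 * (d₁ : ℝ)) * (2 * (d₂ : ℝ) - 2 * (d₁ : ℝ)) * (((d₂ : ℝ) + (d₃ : ℝ)) - 2 * (d₁ : ℝ)) * (2 * (d₃ : ℝ) - 2 * (d₁ : ℝ)) * ((2
      * (d₁ : ℝ) + (d₂ : ℝ)) - 2 * (d₁ : ℝ)) * ((2 * (d₁ : ℝ) + (d₃ : ℝ)) - 2 * (d₁ : ℝ)) * (((d₁ : ℝ) + 2 * (d₂ : ℝ)) - 2 * (d₁ : ℝ)) * (((d₁ : ℝ)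
      + (d₂ : ℝ) + (d₃ : ℝ)) - 2 * (d₁ : ℝ)) * (((d₁ : ℝ) + 2 * (d₃ : ℝ)) - 2 * (d₁ : ℝ)) * (3 * (d₂ : ℝ) - 2 * (d₁ : ℝ)) * ((2 * (d₂ : ℝ)
      + (d₃ : ℝ)) - 2 * (d₁ : ℝ)) * (((d₂ : ℝ) + 2 * (d₃ : ℝ)) - 2 * (d₁ : ℝ)) * (3 * (d₃ : ℝ) - 2 * (d₁ : ℝ)) := ⟨_, rfl⟩
  rw [← hPe_def, ← hP1_def] at C1
  rw [← hPe_def, ← hP2_def] at C2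
  rw [← hPe_def] at hPe
  rw [← hP1_def] at hP1
  rw [← hP2_def] at hP2
  -- P_e · P₂ < P₁²  (the termwise comparison, regrouped)
  have hprod : Pe * P₂ < P₁ ^ 2 := by
    have e1 : Pe * P₂ = ((d₂ : ℝ) * ((d₂ : ℝ) - 2 * (d₁ : ℝ))) * ((d₃ : ℝ) * ((d₃ : ℝ) - 2 * (d₁ : ℝ))) * (((d₁ : ℝ) + (d₂ : ℝ)) * (((d₁ : ℝ)
        + (d₂ : ℝ)) - 2 * (d₁ : ℝ))) * (((d₁ : ℝ) + (d₃ : ℝ)) * (((d₁ : ℝ) + (d₃ : ℝ)) - 2 * (d₁ : ℝ))) * (2 * (d₂ : ℝ) * (2 * (d₂ : ℝ) - 2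
        * (d₁ : ℝ))) * (((d₂ : ℝ) + (d₃ : ℝ)) * (((d₂ : ℝ) + (d₃ : ℝ)) - 2 * (d₁ : ℝ))) * (2 * (d₃ : ℝ) * (2 * (d₃ : ℝ) - 2 * (d₁ : ℝ))) * ((2
        * (d₁ : ℝ) + (d₂ : ℝ)) * ((2 * (d₁ : ℝ) + (d₂ : ℝ)) - 2 * (d₁ : ℝ))) * ((2 * (d₁ : ℝ) + (d₃ : ℝ)) * ((2 * (d₁ : ℝ) + (d₃ : ℝ)) - 2
        * (d₁ : ℝ))) * (((d₁ : ℝ) + 2 * (d₂ : ℝ)) * (((d₁ : ℝ) + 2 * (d₂ : ℝ)) - 2 * (d₁ : ℝ))) * (((d₁ : ℝ) + (d₂ : ℝ) + (d₃ : ℝ)) * (((d₁ : ℝ)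
        + (d₂ : ℝ) + (d₃ : ℝ)) - 2 * (d₁ : ℝ))) * (((d₁ : ℝ) + 2 * (d₃ : ℝ)) * (((d₁ : ℝ) + 2 * (d₃ : ℝ)) - 2 * (d₁ : ℝ))) * (3 * (d₂ : ℝ) * (3
        * (d₂ : ℝ) - 2 * (d₁ : ℝ))) * ((2 * (d₂ : ℝ) + (d₃ : ℝ)) * ((2 * (d₂ : ℝ) + (d₃ : ℝ)) - 2 * (d₁ : ℝ))) * (((d₂ : ℝ) + 2 * (d₃ : ℝ))
        * (((d₂ : ℝ) + 2 * (d₃ : ℝ)) - 2 * (d₁ : ℝ))) * (3 * (d₃ : ℝ) * (3 * (d₃ : ℝ) - 2 * (d₁ : ℝ))) := by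
      rw [hPe_def, hP2_def]; ring
    have e2 : P₁ ^ 2 = ((d₂ : ℝ) - (d₁ : ℝ)) ^ 2 * ((d₃ : ℝ) - (d₁ : ℝ)) ^ 2 * (((d₁ : ℝ) + (d₂ : ℝ)) - (d₁ : ℝ)) ^ 2 * (((d₁ : ℝ) + (d₃ : ℝ))
        - (d₁ : ℝ)) ^ 2 * (2 * (d₂ : ℝ) - (d₁ : ℝ)) ^ 2 * (((d₂ : ℝ) + (d₃ : ℝ)) - (d₁ : ℝ)) ^ 2 * (2 * (d₃ : ℝ) - (d₁ : ℝ)) ^ 2 * ((2 * (d₁ : ℝ)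
        + (d₂ : ℝ)) - (d₁ : ℝ)) ^ 2 * ((2 * (d₁ : ℝ) + (d₃ : ℝ)) - (d₁ : ℝ)) ^ 2 * (((d₁ : ℝ) + 2 * (d₂ : ℝ)) - (d₁ : ℝ)) ^ 2 * (((d₁ : ℝ)
        + (d₂ : ℝ) + (d₃ : ℝ)) - (d₁ : ℝ)) ^ 2 * (((d₁ : ℝ) + 2 * (d₃ : ℝ)) - (d₁ : ℝ)) ^ 2 * (3 * (d₂ : ℝ) - (d₁ : ℝ)) ^ 2 * ((2 * (d₂ : ℝ)
        + (d₃ : ℝ)) - (d₁ : ℝ)) ^ 2 * (((d₂ : ℝ) + 2 * (d₃ : ℝ)) - (d₁ : ℝ)) ^ 2 * (3 * (d₃ : ℝ) - (d₁ : ℝ)) ^ 2 := by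
      rw [hP1_def]; ring
    rw [e1, e2]; exact g15
  -- elimination: tr = −3P_e/P₁, e₂ = 3P_e/P₂, and Newton 3e₂ ≤ tr²
  have hB1 : 0 < 2 * (d₁ : ℝ) ^ 2 * P₁ := by positivity
  have hB2 : 0 < (d₁ : ℝ) ^ 2 * P₂ := by positivity
  have htr : T.trace * (2 * (d₁ : ℝ) ^ 2 * P₁) = -(6 * (d₁ : ℝ) ^ 2 * Pe) := eq_neg_of_add_eq_zero_right C1
  have he2 : (T 0 0 * T 1 1 - T 0 1 * T 1 0 + (T 0 0 * T 2 2 - T 0 2 * T 2 0) + (T 1 1 * T 2 2 - T 1 2 * T 2 1)) * ((d₁ : ℝ) ^ 2 * P₂) = 3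
      * (d₁ : ℝ) ^ 2 * Pe := (sub_eq_zero.mp C2).symm
  have hmul := mul_le_mul_of_nonneg_right hsos (le_of_lt (mul_pos (pow_pos hB1 2) hB2))
  have eq1 : 3 * (T 0 0 * T 1 1 - T 0 1 * T 1 0 + (T 0 0 * T 2 2 - T 0 2 * T 2 0) + (T 1 1 * T 2 2 - T 1 2 * T 2 1)) * ((2 * (d₁ : ℝ) ^ 2 * P₁) ^ 2
      * ((d₁ : ℝ) ^ 2 * P₂))
      = 3 * (3 * (d₁ : ℝ) ^ 2 * Pe) * (2 * (d₁ : ℝ) ^ 2 * P₁) ^ 2 := by rw [← he2]; ring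
  have hsq : (T.trace * (2 * (d₁ : ℝ) ^ 2 * P₁)) ^ 2 = (6 * (d₁ : ℝ) ^ 2 * Pe) ^ 2 := by rw [htr]; ring
  have eq2 : T.trace ^ 2 * ((2 * (d₁ : ℝ) ^ 2 * P₁) ^ 2 * ((d₁ : ℝ) ^ 2 * P₂))
      = (6 * (d₁ : ℝ) ^ 2 * Pe) ^ 2 * ((d₁ : ℝ) ^ 2 * P₂) := by
    rw [← hsq]; ring
  rw [eq1, eq2] at hmul
  -- hmul : 36 d₁⁶ Pe P₁² ≤ 36 d₁⁶ Pe² P₂, contradicting Pe P₂ < P₁²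
  have hlt : (6 * (d₁ : ℝ) ^ 2 * Pe) ^ 2 * ((d₁ : ℝ) ^ 2 * P₂) < 3 * (3 * (d₁ : ℝ) ^ 2 * Pe) * (2 * (d₁ : ℝ) ^ 2 * P₁) ^ 2 := by
    have hk : 0 < 36 * (d₁ : ℝ) ^ 6 * Pe := by positivity
    have hm := mul_lt_mul_of_pos_left hprod hk
    have e3 : (6 * (d₁ : ℝ) ^ 2 * Pe) ^ 2 * ((d₁ : ℝ) ^ 2 * P₂) = 36 * (d₁ : ℝ) ^ 6 * Pe * (Pe * P₂) := by ring
    have e4 : 3 * (3 * (d₁ : ℝ) ^ 2 * Pe) * (2 * (d₁ : ℝ) ^ 2 * P₁) ^ 2 = 36 * (d₁ : ℝ) ^ 6 * Pe * P₁ ^ 2 := by ring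
    rw [e3, e4]; exact hm
  exact absurd hmul (not_le.mpr hlt)

end Summit.ValiantsHypothesis.ValiantsHypothesis.Theorems.LacunarySymmetroidMatrixDescartes.Census.ConfluentNine
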